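import Summits.QuantumFields.YangMills.Theorems.LuscherReductionTwistedTraceScalingBOCentralRatesTwo
import HarnessLib

/-!
# (B-O) central tube — the transport defects `ε_q + ε_tr` vanish along schedule B

Companion of `…BOCentralRecord` / `…BOCentralRates` / `…BOCentralRatesTwo`: the exponents `ε_q + ε_tr` of the lower
(`e^{-(ε_q+ε_tr)}`, slow-mean window version) and of the upper (`e^{ε_q+ε_tr}`, chart version) bound of
`central_transfer_record` tend to `0` along schedule B, for ALL real values of the constants `B, M_T, C_L, K_sp`.
§1 is the abstract statement (exact polynomial identities in the atoms `β·r·ρ, β·r², β·r·r_f, β·ρ²·r_f, β·ρ³, β·ρ⁴`),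
§2 ★ the schedule instantiation.
-/

open MeasureTheory Filter Topology Real
open scoped BigOperators
open Literature.MathematicalPhysics.QuantumFieldTheory
open Literature.MathematicalPhysics.QuantumLattice

namespace Summit.QuantumFields.YangMills.Theorems.FemtoTransferGap.TwoLattice.ConstTube

open Summit.QuantumFields.YangMills.Theorems.FemtoTransferGap
open Summit.QuantumFields.YangMills.Theorems.FemtoTransferGap.TwoLattice

variable {L : ℕ}

/-! ## §1 The abstract vanishing -/

/-- **Abstract vanishing of the transport defects**: if the atoms `r, ρ, β·r·ρ, β·r², β·r·r_f, β·ρ²·r_f, β·ρ³, β·ρ⁴` all tend to `0`,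
then so do both exponents `ε_q + ε_tr` (lower / upper version), whatever the real constants. [folklore] -/
theorem tendsto_transport_defect_abstract {r ρ rf : ℝ → ℝ} (hr : Tendsto r atTop (𝓝 0)) (hρ : Tendsto ρ atTop (𝓝 0))
    (h1 : Tendsto (fun β => β * r β * ρ β) atTop (𝓝 0)) (h2 : Tendsto (fun β => β * r β ^ 2) atTop (𝓝 0))
    (h3 : Tendsto (fun β => β * r β * rf β) atTop (𝓝 0)) (h4 : Tendsto (fun β => β * ρ β ^ 2 * rf β) atTop (𝓝 0))
    (h5 : Tendsto (fun β => β * ρ β ^ 3) atTop (𝓝 0)) (h6 : Tendsto (fun β => β * ρ β ^ 4) atTop (𝓝 0)) (B MT CL Ksp E sE : ℝ) :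
    Tendsto (fun β : ℝ => (((96 * (β / 2) + (β)) * (B * r β + MT * r β ^ 2) * (2 * (((rf β / 12) + (9 / 10 * rf β)) + 14 * E * ρ β ^ 2 + (CL * ((4 + 48 * Ksp) * ρ β) * (9 * Ksp * ρ β) + MT * (9 * Ksp * ρ β) ^ 2)) + (B * r β + MT * r β ^ 2))) + ((96 * (β / 2) + (β)) * ((CL * ((4 + 48 * Ksp) * ρ β) * (9 * Ksp * ρ β) + MT * (9 * Ksp * ρ β) ^ 2) * (2 * (((rf β / 12) + (9 / 10 * rf β)) + 14 * E * ρ β ^ 2 + (CL * ((4 + 48 * Ksp) * ρ β) * (9 * Ksp * ρ β) + MT * (9 * Ksp * ρ β) ^ 2)) + (CL * ((4 + 48 * Ksp) * ρ β) * (9 * Ksp * ρ β) + MT * (9 * Ksp * ρ β) ^ 2)) + 72 * E * ρ β ^ 3)))) atTop (𝓝 0) ∧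
      Tendsto (fun β : ℝ => (((96 * (β / 2) + (β)) * (B * r β + MT * r β ^ 2) * (2 * (sE * ρ β + (7 * E * ρ β + B * (9 * Ksp * ρ β) + MT * (9 * Ksp * ρ β) ^ 2)) + (B * r β + MT * r β ^ 2))) + ((96 * (β / 2) + (β)) * ((CL * ((4 + 48 * Ksp) * ρ β) * (9 * Ksp * ρ β) + MT * (9 * Ksp * ρ β) ^ 2) * (2 * (sE * ρ β + (7 * E * ρ β + B * (9 * Ksp * ρ β) + MT * (9 * Ksp * ρ β) ^ 2)) + (CL * ((4 + 48 * Ksp) * ρ β) * (9 * Ksp * ρ β) + MT * (9 * Ksp * ρ β) ^ 2)) + 72 * E * ρ β ^ 3)))) atTop (𝓝 0) := by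
  set κ : ℝ := CL * (4 + 48 * Ksp) * (9 * Ksp) + MT * (81 * Ksp ^ 2) with hκ
  have T1 : Tendsto (fun β => B + MT * r β) atTop (𝓝 (B + MT * 0)) := tendsto_const_nhds.add (hr.const_mul MT)
  constructor
  · have hlo := (((T1.mul ((((h3.const_mul (59 / 30)).add ((h1.mul hρ).const_mul (28 * E))).add ((h1.mul hρ).const_mul (2 * κ))).add
        (h2.mul T1))).add ((((h4.const_mul (59 / 30)).add (h6.const_mul (28 * E))).add (h6.const_mul (3 * κ))).const_mul κ)).add
        (h5.const_mul (72 * E))).const_mul 49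
    simp only [mul_zero, add_zero, zero_mul] at hlo
    refine hlo.congr' (Eventually.of_forall fun β => ?_)
    simp only [hκ]
    ring
  · have hhi := (((T1.mul ((((h1.const_mul (2 * sE + 14 * E + 18 * B * Ksp)).add ((h1.mul hρ).const_mul (162 * MT * Ksp ^ 2)))).add
        (h2.mul T1))).add ((((h5.const_mul (2 * sE + 14 * E + 18 * B * Ksp)).add (h6.const_mul (162 * MT * Ksp ^ 2))).add
        (h6.const_mul κ)).const_mul κ)).add (h5.const_mul (72 * E))).const_mul 49
    simp only [mul_zero, add_zero, zero_mul] at hhi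
    refine hhi.congr' (Eventually.of_forall fun β => ?_)
    simp only [hκ]
    ring

/-! ## §2 ★ Along schedule B -/

/-- ★ **The transport defects vanish on schedule B**: both exponents `ε_q + ε_tr` of `central_transfer_record`
(`r = β^{-1}ℓ³`, `ρ = 8T`, `r_f = min(1/40, β^{-1/2}ℓ)`, `R_in + R₀ = r_f/12 + (9/10)r_f`) tend to `0`,
for all real `B, M_T, C_L, K_sp`. [folklore] -/
theorem tendsto_transport_defects [NeZero L] (Ksp MT B CL : ℝ) :
    Tendsto (fun β : ℝ => (((96 * (β / 2) + (β)) * (B * (powScale 1 β * btLog β ^ 3) + MT * (powScale 1 β * btLog β ^ 3) ^ 2) * (2 * ((((min (1 / 40) (powScale (1 / 2) β * btLog β)) / 12) + (9 / 10 * (min (1 / 40) (powScale (1 / 2) β * btLog β)))) + 14 * ((Fintype.card (Edge 3 L) : ℝ)) * (8 * (9 * (L : ℝ) * (5 * (powScale (1 / 2) β * btLog β ^ 2)) + (powScale 1 β))) ^ 2 + (CL * ((4 + 48 * Ksp) * (8 * (9 * (L : ℝ) * (5 * (powScale (1 / 2) β * btLog β ^ 2)) + (powScale 1 β)))) * (9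 * Ksp * (8 * (9 * (L : ℝ) * (5 * (powScale (1 / 2) β * btLog β ^ 2)) + (powScale 1 β)))) + MT * (9 * Ksp * (8 * (9 * (L : ℝ) * (5 * (powScale (1 / 2) β * btLog β ^ 2)) + (powScale 1 β)))) ^ 2)) + (B * (powScale 1 β * btLog β ^ 3) + MT * (powScale 1 β * btLog β ^ 3) ^ 2))) + ((96 * (β / 2) + (β)) * ((CL * ((4 + 48 * Ksp) * (8 * (9 * (L : ℝ) * (5 * (powScale (1 / 2) β * btLog β ^ 2)) + (powScale 1 β)))) * (9 * Ksp * (8 * (9 * (L : ℝ) * (5 * (powScale (1 / 2) β * btLog β ^ 2)) + (powScale 1 β)))) + MT * (9 * Ksp * (8 * (9 * (L : ℝ) * (5 * (powScale (1 / 2) β * btLog β ^ 2)) + (powScale 1 β)))) ^ 2) * (2 * ((((min (1 / 40) (powScale (1 / 2) β * btLog β)) / 12) + (9 / 10 * (min (1 / 40) (powScale (1 / 2) β * btLog β)))) + 14 * ((Fintype.card (Edge 3 L) : ℝ)) * (8 * (9 * (L : ℝ) * (5 * (powScale (1 / 2) β * btLog β ^ 2)) + (powScale 1 β))) ^ 2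 + (CL * ((4 + 48 * Ksp) * (8 * (9 * (L : ℝ) * (5 * (powScale (1 / 2) β * btLog β ^ 2)) + (powScale 1 β)))) * (9 * Ksp * (8 * (9 * (L : ℝ) * (5 * (powScale (1 / 2) β * btLog β ^ 2)) + (powScale 1 β)))) + MT * (9 * Ksp * (8 * (9 * (L : ℝ) * (5 * (powScale (1 / 2) β * btLog β ^ 2)) + (powScale 1 β)))) ^ 2)) + (CL * ((4 + 48 * Ksp) * (8 * (9 * (L : ℝ) * (5 * (powScale (1 / 2) β * btLog β ^ 2)) + (powScale 1 β)))) * (9 * Ksp * (8 * (9 * (L : ℝ) * (5 * (powScale (1 / 2) β * btLog β ^ 2)) + (powScale 1 β)))) + MT * (9 * Ksp * (8 * (9 * (L : ℝ) * (5 * (powScale (1 / 2) β * btLog β ^ 2)) + (powScale 1 β)))) ^ 2)) + 72 * ((Fintype.card (Edge 3 L) : ℝ)) * (8 * (9 * (L : ℝ) * (5 * (powScale (1 / 2) β * btLog β ^ 2)) + (powScale 1 β))) ^ 3)))) atTop (𝓝 0) ∧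
      Tendsto (fun β : ℝ => (((96 * (β / 2) + (β)) * (B * (powScale 1 β * btLog β ^ 3) + MT * (powScale 1 β * btLog β ^ 3) ^ 2) * (2 * (Real.sqrt ((Fintype.card (Edge 3 L) : ℝ)) * (8 * (9 * (L : ℝ) * (5 * (powScale (1 / 2) β * btLog β ^ 2)) + (powScale 1 β))) + (7 * ((Fintype.card (Edge 3 L) : ℝ)) * (8 * (9 * (L : ℝ) * (5 * (powScale (1 / 2) β * btLog β ^ 2)) + (powScale 1 β))) + B * (9 * Ksp * (8 * (9 * (L : ℝ) * (5 * (powScale (1 / 2) β * btLog β ^ 2)) + (powScale 1 β)))) + MT * (9 * Ksp * (8 * (9 * (L : ℝ) * (5 * (powScale (1 / 2) β * btLog β ^ 2)) + (powScale 1 β)))) ^ 2)) + (B * (powScale 1 β * btLog β ^ 3) + MT * (powScale 1 β * btLog β ^ 3) ^ 2))) + ((96 * (β / 2) + (β)) * ((CL * ((4 + 48 * Ksp) * (8 * (9 * (L : ℝ) * (5 * (powScale (1 / 2) β * btLog β ^ 2)) + (powScale 1 β)))) * (9 * Ksp * (8 * (9 * (L : ℝ) * (5 * (powScale (1 / 2)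 β * btLog β ^ 2)) + (powScale 1 β)))) + MT * (9 * Ksp * (8 * (9 * (L : ℝ) * (5 * (powScale (1 / 2) β * btLog β ^ 2)) + (powScale 1 β)))) ^ 2) * (2 * (Real.sqrt ((Fintype.card (Edge 3 L) : ℝ)) * (8 * (9 * (L : ℝ) * (5 * (powScale (1 / 2) β * btLog β ^ 2)) + (powScale 1 β))) + (7 * ((Fintype.card (Edge 3 L) : ℝ)) * (8 * (9 * (L : ℝ) * (5 * (powScale (1 / 2) β * btLog β ^ 2)) + (powScale 1 β))) + B * (9 * Ksp * (8 * (9 * (L : ℝ) * (5 * (powScale (1 / 2) β * btLog β ^ 2)) + (powScale 1 β)))) + MT * (9 * Ksp * (8 * (9 * (L : ℝ) * (5 * (powScale (1 / 2) β * btLog β ^ 2)) + (powScale 1 β)))) ^ 2)) + (CL * ((4 + 48 * Ksp) * (8 * (9 * (L : ℝ) * (5 * (powScale (1 / 2) β * btLog β ^ 2)) + (powScale 1 β)))) * (9 * Ksp * (8 * (9 * (L : ℝ) * (5 * (powScale (1 / 2) β * btLog β ^ 2)) + (powScale 1 β)))) + MT * (9 * Ksp * (8 * (9 * (L : ℝ)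 * (5 * (powScale (1 / 2) β * btLog β ^ 2)) + (powScale 1 β)))) ^ 2)) + 72 * ((Fintype.card (Edge 3 L) : ℝ)) * (8 * (9 * (L : ℝ) * (5 * (powScale (1 / 2) β * btLog β ^ 2)) + (powScale 1 β))) ^ 3)))) atTop (𝓝 0) :=
  tendsto_transport_defect_abstract (r := fun β => powScale 1 β * btLog β ^ 3)
    (ρ := fun β => 8 * (9 * (L : ℝ) * (5 * (powScale (1 / 2) β * btLog β ^ 2)) + powScale 1 β))
    (rf := fun β => min (1 / 40) (powScale (1 / 2) β * btLog β)) tendsto_schedCore tendsto_schedRho (tendsto_beta_core_rho (L := L)).1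
    (tendsto_beta_core_rho (L := L)).2 tendsto_beta_core_rf tendsto_beta_rho_sq_rf tendsto_beta_rho_cube tendsto_beta_rho_four B MT CL Ksp
    ((Fintype.card (Edge 3 L) : ℝ)) (Real.sqrt ((Fintype.card (Edge 3 L) : ℝ)))

end Summit.QuantumFields.YangMills.Theorems.FemtoTransferGap.TwoLattice.ConstTube
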